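import Summits.ResolutionOfSingularities.ResolutionOfSingularities.Theorems.DescentDescentPerfectToAllPerfectBase
import Summits.ResolutionOfSingularities.ResolutionOfSingularities.Theorems.DescentDescentPerfectToAllPIndependence
import HarnessLib

/-!
# `DescentPerfectToAll` (stmt-ResolutionOfSingularities-0549) for ALL ground fields of transcendence degree
# `≤ 1` over SOME PERFECT SUBFIELD

Route `ResolutionOfSingularities/Descent`, crux `DescentPerfectToAll`. Helper (OURS; not a statement of any
manuscript; `--supports` the crux, does not close it). `DescentDescentPerfectToAllTrdegLEOne.lean` proves the
crux's conclusion (given its antecedent) for ground fields of transcendence degree `≤ 1` over the PRIME field;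
`DescentDescentPerfectToAllPerfectBase.lean` runs the finite-`p`-basis layer over an arbitrary perfect subfield
`P ≤ k`. This file combines them into the clean statement «`Algebra.trdeg P k ≤ 1` for some perfect subfield
`P`» — new instances: every algebraic extension of `P(t)` for a perfect `P` of any transcendence degree over
`𝔽_p` (e.g. `P = 𝔽_p(u^{1/p^∞})`, `k = P(t)(y₁, y₂, …)`), fields the prime-field statement does not reach:

* `transcendental_of_forall_pow_ne_of_perfect` — a non-`p`-th power `t ∈ k` is transcendental over every
  perfect subfield `P` (else `P(t)` would be a finite, hence perfect, extension of `P`, and `t ∈ P(t)^p ⊆ k^p`).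
* `perfectField_or_exists_of_trdeg_perfect_le_one` — `trdeg_P k ≤ 1` ⇒ `k` perfect, or algebraic over `P(t)`
  for some `t ∉ k^p` (`{t}` is a transcendence basis by the dimension count).
* `pIndependent_single_of_forall_pow_ne` — `t ∉ k^p` ⇒ the one-element family `t` is `p`-independent (chain
  criterion `pIndependent_of_chain` with one link).
* `hasResolution_of_perfectRes_of_trdeg_perfect_le_one` / `descentPerfectToAll_trdeg_perfect_le_one` —
  **resolution over all perfect fields of characteristic `p` implies resolution of every reduced separated
  scheme of finite type over every ground field of transcendence degree `≤ 1` over some perfect subfield**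
  (all dimensions).
-/

noncomputable section

set_option linter.dupNamespace false -- mandated namespace of this single-conjunct summit

open CategoryTheory CategoryTheory.Limits AlgebraicGeometry
open Literature.AlgebraicGeometry.Resolution

namespace Summit.ResolutionOfSingularities.ResolutionOfSingularities.Theorems

/-! ## Transcendence degree `≤ 1` over a perfect subfield -/

section TrdegOne

variable {p : ℕ} [Fact p.Prime] {k : Type} [Field k] [CharP k p]

variable (p) in
/-- **A non-`p`-th power is transcendental over every perfect subfield.** If `P ≤ k` is perfect and `t ∈ k`
were algebraic over `P`, then `P(t)` would be a finite — hence perfect (`Algebra.IsAlgebraic.perfectField`) —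
extension of `P`, so `t = s^p` for some `s ∈ P(t) ⊆ k`. [folklore] -/
theorem transcendental_of_forall_pow_ne_of_perfect (P : Subfield k) (hP : ∀ x ∈ P, ∃ y ∈ P, y ^ p = x)
    {t : k} (ht : ∀ s : k, s ^ p ≠ t) : Transcendental P t := by
  have hp : p.Prime := Fact.out
  haveI := perfectField_subfield_of_forall_exists_pow_eq p P hP
  intro halg
  set L := IntermediateField.adjoin P ({t} : Set k) with hL
  haveI : FiniteDimensional P L := IntermediateField.adjoin.finiteDimensional halg.isIntegral
  haveI : Algebra.IsAlgebraic P L := Algebra.IsAlgebraic.of_finite P L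
  haveI : PerfectField L := Algebra.IsAlgebraic.perfectField P
  haveI : CharP L p := (algebraMap L k).charP Subtype.val_injective p
  haveI : ExpChar L p := ExpChar.prime hp
  haveI : PerfectRing L p := PerfectField.toPerfectRing p
  obtain ⟨s, hs⟩ := surjective_frobenius L p ⟨t, IntermediateField.mem_adjoin_simple_self P t⟩
  apply ht s
  have := congrArg Subtype.val hs
  simpa [frobenius_def] using this

variable (p) in
/-- **"Transcendence degree `≤ 1` over a perfect subfield", unfolded.** If `P ≤ k` is perfect and
`Algebra.trdeg P k ≤ 1`, then `k` is perfect, or it contains a non-`p`-th power `t` — transcendental over `P`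
(`transcendental_of_forall_pow_ne_of_perfect`), hence a transcendence basis of `k / P` by the dimension count —
and `k` is algebraic over `closure (P ∪ range ![t]) = P(t)`. [folklore] -/
theorem perfectField_or_exists_of_trdeg_perfect_le_one (P : Subfield k)
    (hP : ∀ x ∈ P, ∃ y ∈ P, y ^ p = x) (htr : Algebra.trdeg P k ≤ 1) :
    PerfectField k ∨ ∃ t : k, (∀ s : k, s ^ p ≠ t) ∧
      Algebra.IsAlgebraic (Subfield.closure ((↑P : Set k) ∪ Set.range ![t])) k := by
  classical
  have hp : p.Prime := Fact.out
  haveI : ExpChar k p := ExpChar.prime hp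
  by_cases hperf : PerfectField k
  · exact Or.inl hperf
  right
  -- a non-`p`-th power
  obtain ⟨t, ht⟩ : ∃ t : k, ∀ s : k, s ^ p ≠ t := by
    by_contra h
    simp only [not_exists, not_forall, ne_eq, not_not] at h
    apply hperf
    haveI := PerfectRing.ofSurjective k p fun x => by
      obtain ⟨s, hs⟩ := h x
      exact ⟨s, by rw [frobenius_def]; exact hs⟩
    exact PerfectRing.toPerfectField k p
  refine ⟨t, ht, ?_⟩
  -- `{t}` is a transcendence basis of `k / P`
  have htrans : Transcendental P t := transcendental_of_forall_pow_ne_of_perfect p P hP ht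
  have hx : AlgebraicIndependent P ![t] :=
    algebraicIndependent_unique_type_iff.mpr (by simpa using htrans)
  have hB : IsTranscendenceBasis P ![t] :=
    hx.isTranscendenceBasis_of_trdeg_le_of_finite (by simpa using htr)
  have halg := hB.isAlgebraic_field
  -- `P(t) = closure (P ∪ range ![t])` as subfields; move the instance along the inclusion
  set K1 := IntermediateField.adjoin P (Set.range ![t]) with hK1
  have hle : K1.toSubfield ≤ Subfield.closure ((↑P : Set k) ∪ Set.range ![t]) :=
    (closure_perfect_range_eq_adjoin_toSubfield P ![t]).symm.le
  letI : Algebra K1 (Subfield.closure ((↑P : Set k) ∪ Set.range ![t])) :=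
    (Subfield.inclusion hle : K1.toSubfield →+* Subfield.closure ((↑P : Set k) ∪ Set.range ![t])).toAlgebra
  haveI : IsScalarTower K1 (Subfield.closure ((↑P : Set k) ∪ Set.range ![t])) k :=
    IsScalarTower.of_algebraMap_eq fun _ => rfl
  exact Algebra.IsAlgebraic.extendScalars (R := K1) (S := Subfield.closure ((↑P : Set k) ∪ Set.range ![t]))
    (Subfield.inclusion hle).injective

variable (p) in
/-- **A non-`p`-th power is a one-element `p`-independent family**: if `t ∉ k^p` then the reduced monomials
`1, t, …, t^{p-1}` are linearly independent over `k^p` (the chain criterion `pIndependent_of_chain` with one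
link, `k^p(∅) = k^p`). [folklore] -/
theorem pIndependent_single_of_forall_pow_ne {t : k} (ht : ∀ s : k, s ^ p ≠ t) :
    ∀ e : (Fin 1 → Fin p) → k, ∑ α, (∏ i, ![t] i ^ (α i : ℕ)) * e α ^ p = 0 → ∀ α, e α = 0 := by
  refine pIndependent_of_chain ![t] fun j => ?_
  have hj : j = 0 := Subsingleton.elim j 0
  subst hj
  have hempty : ![t] '' {i : Fin 1 | i < 0} = ∅ := by
    rw [Set.image_eq_empty]
    ext i
    simp only [Set.mem_setOf_eq, Set.mem_empty_iff_false, iff_false, not_lt]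
    exact Fin.zero_le i
  rw [hempty, Set.union_empty]
  -- `closure (range (· ^ p)) = k^p`
  intro hmem
  have hsub : Subfield.closure (Set.range fun x : k => x ^ p) ≤ (frobenius k p).fieldRange := by
    rw [Subfield.closure_le]
    rintro x ⟨y, rfl⟩
    exact RingHom.mem_fieldRange.mpr ⟨y, frobenius_def ..⟩
  obtain ⟨s, hs⟩ := RingHom.mem_fieldRange.mp (hsub hmem)
  exact ht s (by rw [← frobenius_def]; exact hs)

/-- **Resolution over perfect fields ⇒ resolution over every ground field of transcendence degree `≤ 1` over
some perfect subfield** (reduced separated schemes of finite type of any dimension): by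
`perfectField_or_exists_of_trdeg_perfect_le_one` the field is perfect (and the antecedent applies directly) or
algebraic over `P(t)` with `t ∉ k^p` (and `hasResolution_of_perfectRes_of_pIndependent_perfect` applies). The
case `P = 𝔽_p` is `hasResolution_of_perfectRes_of_trdeg_le_one`; new instances: every algebraic extension of
`P(t)`, `P` perfect of any transcendence degree (e.g. `P = 𝔽_p(u^{1/p^∞})`). [folklore] -/
theorem hasResolution_of_perfectRes_of_trdeg_perfect_le_one (p : ℕ) [Fact p.Prime]
    (H : ∀ (κ : Type) [Field κ] [CharP κ p] [PerfectField κ] (Z : Scheme.{0}) (h : Z ⟶ Spec (.of κ)),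
      IsSeparated h → LocallyOfFiniteType h → QuasiCompact h → IsReduced Z → Scheme.HasResolution Z)
    (k : Type) [Field k] [CharP k p] (P : Subfield k) (hP : ∀ x ∈ P, ∃ y ∈ P, y ^ p = x)
    (htr : Algebra.trdeg P k ≤ 1)
    (X : Scheme.{0}) (f : X ⟶ Spec (.of k)) [IsSeparated f] [LocallyOfFiniteType f] [QuasiCompact f]
    [IsReduced X] : Scheme.HasResolution X := by
  classical
  rcases perfectField_or_exists_of_trdeg_perfect_le_one p P hP htr with hperf | ⟨t, ht, halg⟩
  · haveI := hperf
    exact H k X f ‹_› ‹_› ‹_› ‹_›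
  · haveI := halg
    exact hasResolution_of_perfectRes_of_pIndependent_perfect p H k P hP ![t]
      (pIndependent_single_of_forall_pow_ne p ht) X f

/-- **The «transcendence degree `≤ 1` over a perfect subfield» layer of the crux `DescentPerfectToAll`,
proved** (binder shape of stmt-0549 with the hypotheses "`P ≤ k` perfect" and "`Algebra.trdeg P k ≤ 1`"
inserted). [folklore] -/
theorem descentPerfectToAll_trdeg_perfect_le_one :
    ∀ p : ℕ, p.Prime → (∀ (k : Type) [Field k] [CharP k p] [PerfectField k] (X : Scheme.{0})
      (f : X ⟶ Spec (.of k)), IsSeparated f → LocallyOfFiniteType f → QuasiCompact f →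
        IsReduced X → Scheme.HasResolution X) →
    ∀ (k : Type) [Field k] [CharP k p] (P : Subfield k), (∀ x ∈ P, ∃ y ∈ P, y ^ p = x) →
      Algebra.trdeg P k ≤ 1 →
      ∀ (X : Scheme.{0}) (f : X ⟶ Spec (.of k)),
        IsSeparated f → LocallyOfFiniteType f → QuasiCompact f → IsReduced X →
          Scheme.HasResolution X := by
  intro p hp H k _ _ P hP htr X f _ _ _ _
  haveI : Fact p.Prime := ⟨hp⟩
  exact hasResolution_of_perfectRes_of_trdeg_perfect_le_one p (fun κ _ _ _ Z h a b c d => H κ Z h a b c d)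
    k P hP htr X f

end TrdegOne

end Summit.ResolutionOfSingularities.ResolutionOfSingularities.Theorems

end
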